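import Literature.Computability.Cryptography.ChenQuantumLWEOutputLaw

/-!
# The withdrawn display of Chen's Step 9 is false for every admissible shape

REPRODUCTION / ANALYSIS OF A CLAIMED RESULT UNDER ADJUDICATION (withdrawn): Yilei Chen, *Quantum
Algorithms for Lattice Problems*, IACR ePrint 2024/555, version of 2024-04-18 [ChenQuantumLattice2024],
§3.5.9 p. 37, the displayed equation for `|φ8.g⟩`, retracted by the author ("the expression of `|φ8.g⟩`
is wrong", note p. 37; see the header of `ChenQuantumLWESteps.lean`).  Bundle
`papers/QuantumAdvantage/lwe-quantum-autopsy/` (Part 1).  HONEST FRAMING: a kernel-checked THEOREM deciding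
(negatively) a typed statement of a WITHDRAWN paper — a precise negative result, NOT summit progress, no
cryptanalytic claim.

`ChenQuantumLWESteps.lean` types the withdrawn equation as the named statement
`Shape.Step9Display : domainExtFirst Q |φ8.f⟩ = |φ8.g⟩(displayed)` over `n+1` registers and does not assert
it.  `ChenQuantumLWEStepNine.lean` (Part 4) refutes its two-register shadow by SUPPORT COUNTING (`P·Q`
versus `P` basis vectors).  Here the full `(n+1)`-register statement is refuted for EVERY `Shape.Admissible`
by TOTAL AMPLITUDE, which needs no injectivity of `j ↦ |2D²j b* + v*⟩`:
* `sum_domainExtFirst` — Lemma 2.17's first-coordinate extension multiplies the total amplitude by `C`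
  (the map `z ↦ (z₀ mod P, z')` is `C`-to-one);
* `Shape.sum_phi8f`, `Shape.sum_phi8gDisplayed` — both kets have total amplitude `G = Σ_{j<P} e(-j²/P)`;
* `Shape.norm_sq_chirpSum` — `|G|² = P` (odd-modulus quadratic Gauss sum, `Literature.NumberTheory.GaussSums`);
* `Shape.not_step9Display` — hence the display would force `Q·G = G`, i.e. `Q = 1`, contradicting `Q ≥ 3`.
-/

namespace Literature.Computability.Cryptography.Chen2024

open scoped BigOperators

/-! ### Counting lemmas -/

/-- Euclidean-division reindexing: `Σ_{m < C·P} g(m mod P) = C · Σ_{r < P} g(r)`. [folklore] -/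
theorem sum_range_mul_mod (C P : ℕ) (g : ℕ → ℂ) :
    ∑ m ∈ Finset.range (C * P), g (m % P) = C * ∑ r ∈ Finset.range P, g r := by
  induction C with
  | zero => simp
  | succ C ih =>
    rw [Nat.succ_mul, Finset.sum_range_add, ih]
    have h : ∀ x ∈ Finset.range P, g ((C * P + x) % P) = g x := by
      intro x hx
      rw [Nat.mul_add_mod', Nat.mod_eq_of_lt (Finset.mem_range.1 hx)]
    rw [Finset.sum_congr rfl h]
    push_cast
    ring

/-- The reduction map `ZMod (C·P) → ZMod P` is `C`-to-one on sums: `Σ_{z} g(z mod P) = C · Σ_x g(x)`.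
[folklore] -/
theorem sum_zmod_mul_castHom (C P : ℕ) [NeZero P] [NeZero (C * P)] (g : ZMod P → ℂ) :
    ∑ z : ZMod (C * P), g (ZMod.castHom (dvd_mul_left P C) (ZMod P) z) = C * ∑ x : ZMod P, g x := by
  have h1 : ∑ z : ZMod (C * P), g (ZMod.castHom (dvd_mul_left P C) (ZMod P) z)
      = ∑ m ∈ Finset.range (C * P), g (ZMod.castHom (dvd_mul_left P C) (ZMod P) (m : ZMod (C * P))) :=
    (sum_range_eq_sum_zmod (C * P) (fun z => g (ZMod.castHom (dvd_mul_left P C) (ZMod P) z))).symm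
  have h2 : ∑ x : ZMod P, g x = ∑ r ∈ Finset.range P, g (r : ZMod P) :=
    (sum_range_eq_sum_zmod P g).symm
  have h3 : ∀ m : ℕ, g (ZMod.castHom (dvd_mul_left P C) (ZMod P) (m : ZMod (C * P)))
      = g (((m % P : ℕ)) : ZMod P) := by
    intro m
    rw [map_natCast, ZMod.natCast_mod]
  rw [h1, h2]
  simp_rw [h3]
  exact sum_range_mul_mod C P (fun r => g (r : ZMod P))

/-- Lemma 2.17 on the first coordinate multiplies the TOTAL amplitude by `C`:
`Σ_z (domainExtFirst C ψ) z = C · Σ_w ψ w`. [cite: ChenQuantumLattice2024, Lemma 2.17 p. 14] -/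
theorem sum_domainExtFirst {n P : ℕ} (C : ℕ) [NeZero P] [NeZero (C * P)] (ψ : Ket (n + 1) P) :
    ∑ z, domainExtFirst C ψ z = C * ∑ w, ψ w := by
  have hw : ∑ w, ψ w = ∑ x : ZMod P, ∑ z' : Fin n → ZMod P, ψ (Fin.cons x z') := by
    rw [← Fintype.sum_prod_type']
    exact ((Fin.consEquiv fun _ => ZMod P).sum_comp ψ).symm
  rw [hw, Fintype.sum_prod_type, Finset.sum_comm]
  simp only [domainExtFirst]
  rw [Finset.sum_congr rfl fun z' _ => sum_zmod_mul_castHom C P (fun x => ψ (Fin.cons x z')),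
    ← Finset.mul_sum, Finset.sum_comm]

/-- Total amplitude of a ket written as a family of basis vectors with coefficients:
`Σ_y Σ_{k∈s} [y = B k] f k = Σ_{k∈s} f k`. [folklore] -/
theorem sum_ite_family {β : Type*} [Fintype β] [DecidableEq β] (s : Finset ℕ) (B : ℕ → β)
    (f : ℕ → ℂ) : ∑ y, (∑ k ∈ s, if y = B k then f k else 0) = ∑ k ∈ s, f k := by
  rw [Finset.sum_comm]
  exact Finset.sum_congr rfl fun k _ => Fintype.sum_ite_eq' (B k) fun _ => f k

namespace Shape

variable (S : Shape)

/-- Total amplitude of `|φ8.f⟩` (eq. (40)) is the chirp sum `G = Σ_{j<P} e(-j²/P)`.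
[cite: ChenQuantumLattice2024, eq. (40) p. 36] -/
theorem sum_phi8f : ∑ w, S.phi8f w = ∑ j ∈ Finset.range S.P, e (-((j : ℚ) ^ 2) / S.P) :=
  sum_ite_family _ S.pt8f _

/-- Total amplitude of the DISPLAYED `|φ8.g⟩` (p. 37) is the same chirp sum `G`.
[cite: ChenQuantumLattice2024, §3.5.9 p. 37] -/
theorem sum_phi8gDisplayed :
    ∑ z, S.phi8gDisplayed z = ∑ j ∈ Finset.range S.P, e (-((j : ℚ) ^ 2) / S.P) :=
  sum_ite_family _
    (fun j => ((((2 * (S.D : ℤ) ^ 2 * j * S.bstar 0 : ℤ) : ZMod ((S.Q : ℕ) * S.N))),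
      fun t => S.pt8f j (Fin.succ t))) _

/-- `|G|² = P` for the chirp sum `G = Σ_{j<P} e(-j²/P)` of an admissible shape (`P = p₁Q` odd):
the odd-modulus quadratic Gauss sum with leading coefficient `-1`.
[cite: Korobov1992, Ch. I §3 Thm 3, eq. (41)] -/
theorem norm_sq_chirpSum (h : S.Admissible) :
    ‖∑ j ∈ Finset.range S.P, e (-((j : ℚ) ^ 2) / S.P)‖ ^ 2 = (S.P : ℕ) := by
  have hP : Odd (S.P : ℕ) := by
    have := h.odd_p₁.mul h.odd_Q
    simpa [Shape.P, PNat.mul_coe] using this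
  have h1 : ∀ j : ℕ, e (-((j : ℚ) ^ 2) / S.P)
      = ZMod.stdAddChar ((-1) * ((j : ℕ) : ZMod S.P) ^ 2 + 0 * ((j : ℕ) : ZMod S.P)) := by
    intro j
    have hq : (-((j : ℚ) ^ 2) / S.P) = (((-((j : ℤ) ^ 2)) : ℤ) : ℚ) / S.P := by
      push_cast
      ring
    rw [hq, e_intCast_div_eq_stdAddChar]
    congr 1
    push_cast
    ring
  simp_rw [h1]
  have h2 : ∑ j ∈ Finset.range (S.P : ℕ),
      ZMod.stdAddChar ((-1) * ((j : ℕ) : ZMod S.P) ^ 2 + 0 * ((j : ℕ) : ZMod S.P))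
        = ∑ x : ZMod S.P, ZMod.stdAddChar ((-1) * x ^ 2 + 0 * x) :=
    sum_range_eq_sum_zmod S.P (fun x => ZMod.stdAddChar ((-1) * x ^ 2 + 0 * x))
  rw [h2]
  exact Literature.NumberTheory.GaussSums.norm_sq_sum_stdAddChar_quadratic _ hP (-1) 0 isUnit_one.neg

/-- **The withdrawn display is false.**  For every admissible shape, Lemma 2.17 applied to the first
coordinate of `|φ8.f⟩` is NOT the displayed `|φ8.g⟩` of p. 37: the left side has total amplitude `Q·G`,
the right side `G`, and `G ≠ 0` (`|G|² = P`) while `Q ≥ 3`.  (The author's note p. 37 withdraws exactly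
this display; Part 4's `ChenQuantumLWEStepNine` refutes its two-register shadow by support counting.)
[cite: ChenQuantumLattice2024, §3.5.9 p. 37 (display and author's note)] -/
theorem not_step9Display (h : S.Admissible) : ¬ S.Step9Display := by
  intro hd
  have hd' : domainExtFirst (S.Q : ℕ) S.phi8f = S.phi8gDisplayed := hd
  have hsum : ∑ z, domainExtFirst (S.Q : ℕ) S.phi8f z = ∑ z, S.phi8gDisplayed z := by rw [hd']
  rw [sum_domainExtFirst, S.sum_phi8f, S.sum_phi8gDisplayed] at hsum
  have hG : (∑ j ∈ Finset.range S.P, e (-((j : ℚ) ^ 2) / S.P)) ≠ 0 := by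
    intro h0
    have hn := S.norm_sq_chirpSum h
    rw [h0, norm_zero, zero_pow two_ne_zero] at hn
    exact (NeZero.ne (S.P : ℕ)) (by exact_mod_cast hn.symm)
  have hQ1 : ((S.Q : ℕ) : ℂ) = 1 := by
    have h2 : ((S.Q : ℕ) : ℂ) * (∑ j ∈ Finset.range S.P, e (-((j : ℚ) ^ 2) / S.P))
        = 1 * (∑ j ∈ Finset.range S.P, e (-((j : ℚ) ^ 2) / S.P)) := by
      rw [one_mul]
      exact hsum
    exact mul_right_cancel₀ hG h2
  have hQ : (S.Q : ℕ) = 1 := by exact_mod_cast hQ1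
  have h3 := h.three_le_Q
  omega

end Shape

end Literature.Computability.Cryptography.Chen2024
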